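import Summits.HodgeConjecture.HodgeConjecture.Theorems.F0LD2SoftRoadZBricks
import Summits.HodgeConjecture.HodgeConjecture.Theorems.F0LD2SoftRoadGlue
import Summits.HodgeConjecture.HodgeConjecture.Theorems.F0LD2CentreDetCharExists
import Summits.HodgeConjecture.HodgeConjecture.Theorems.F0LD2KudlaLinesToCoinvDisjoint
import Summits.HodgeConjecture.HodgeConjecture.Theorems.F0LD2SoftRoadZLambda
import Summits.HodgeConjecture.HodgeConjecture.Theorems.F0LD2OperatorWords
import HarnessLib

-- the organ statement elaborates to a very large type; elaborate sequentially (as in the ★ kit lineage)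
set_option Elab.async false

/-!
# Crux `HLiu418`, line LD2 — THE ORGAN `LineThetaTypesComplementary₁` FROM THE SOFT ROAD, modulo exactly {`ZLambda`, `ZVan`} (EDITION 1)

Cell hodgecm-mathlib, floor 0; seat LD1-p01 (g3) for LD2-plan (g3) (DEALS #21, 2026-09-02); `--supports stmt-HodgeConjecture-24832 --as helper`.
Namespace `Summit.HodgeConjecture.HodgeConjecture.Cruxes.HLiu418.F0LD2SoftRoadJunction` (the junction's).  THEOREMS ONLY.

The soft road of the LTC₁ organ («the two CM line theta packages have complementary local types», books row #188; leaf
`Cruxes/HLiu418/Lines/F0_P6LD_StubS1bFactsOrganRoad.lean` stub `stub_organ_lineTypes₁`, twin socket in the LD1 leaf) is the composition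
`(E) → (Z) → ((D) → (C)) → LineThetaTypesComplementary₁` (★ `F0LD2SoftRoadGlue.lineThetaTypesComplementary₁_of_softRoad`, LD2-plan (g3)), with
(E) ★ `F0LD2CentreDetCharExists.centreDetCharExists` (A-p13 (g40)), (D) → (C) ★ `F0LD2KudlaLinesToCoinvDisjoint.coinvDisjoint₁_of_kudlaLinesDisjoint`
(B-p04 (g45)), and (Z) `AnisotropicPlaneCentreTypeVanishes` CUT into the two bricks ★ `F0LD2SoftRoadZBricks.{ZLambda, ZVan}` (B-p04 (g45)):
(Z) follows from them by contradiction (the non-zero twisted-section-invariant functional of (Z-Λ) vanishes by (Z-van)) — that five-line step is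
INLINED in the proof below (it is also the separate closer `anisotropicPlaneCentreTypeVanishes_of_zBricks` of B-p04's plate (b); no dependency either way).

* EDITION 1: `lineThetaTypesComplementary₁_of_z : ZLambda → ZVan → LineThetaTypesComplementary₁` (this file; = LD2-plan's HOME docking cert
  `organ_of_Z`, kernel-checked there over the same bytes).
* EDITION 2 (append-only; ★ `F0LD2SoftRoadZLambda.zLambda_body` (B-p04 (g45), p851111) docks `ZLambda` by δ): `lineThetaTypesComplementary₁_of_zVan :
  ZVan → LineThetaTypesComplementary₁` — THE ORGAN HANGS ON (Z-van) ALONE.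
* EDITION 3 (append-only; ★ `F0LD2SoftRoadJunction.zVan_holds` (A-p19 (g31), `Theorems.F0LD2OperatorWords` p851259, = `zVan_of_operatorWords
  operatorWords_holds`)): `lineThetaTypesComplementary₁_holds : LineThetaTypesComplementary₁` — THE ORGAN, sorry-free ⇒ both leaves dock
  `stub_organ_lineTypes₁` by name.

HONEST LABEL.  Nothing printed is discharged; HC_CM is proved only modulo the 7 printed citations (2 remaining: hLiu418 = stmt-HodgeConjecture-24832,
h413 = stmt-HodgeConjecture-24833) until rung 0 closes; count-neutral.
References (prose locators): Gelbart–Rogawski 1991 §3.2 (3.2.2)–(3.2.3) p. 457; Harris–Kudla–Sweet 1996 §6 Thm. 6.1; Kudla 1994 §3 Thm. 3.1;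
Mœglin–Vignéras–Waldspurger 1987 Chap. 3 §IV.4.
-/

set_option autoImplicit false
set_option linter.dupNamespace false

noncomputable section

open scoped Matrix Kronecker
open NumberField IsDedekindDomain MeasureTheory
open Literature.NumberTheory Literature.NumberTheory.Automorphic Literature.NumberTheory.Automorphic.UnitaryGroup
open Literature.RepresentationTheory Literature.RepresentationTheory.HeisenbergGroup Literature.RepresentationTheory.TwistedCoinv
open Literature.NumberTheory.GelbartRogawski1991 Literature.NumberTheory.GelbartRogawski1991.UnitaryDualPair
open Literature.NumberTheory.GelbartRogawski1991.UnitaryDualPair.WeilCoinv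
open Literature.NumberTheory.GelbartRogawski1991.UnitaryDualPair.LocalSplitting
open Literature.NumberTheory.GelbartRogawski1991.GRConstruction
open Literature.NumberTheory.Weil1964
open Literature.NumberTheory.GaloisRepresentations Literature.RepresentationTheory.HarrisKudlaSweet1996
open Literature.NumberTheory.Automorphic.IdeleClassGroup Literature.RepresentationTheory.Liu2021
open Literature.NumberTheory.Automorphic.Liu2021 Literature.NumberTheory.Automorphic.Liu2021.Def411WeilCarriers
open Literature.NumberTheory.Automorphic.Liu2021.Def411WeilCarriersDoubling
open Literature.NumberTheory.Automorphic.Liu2021.LemD1RankTwoCMLetters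
open Literature.RepresentationTheory.MoeglinVignerasWaldspurger1987
open Literature.NumberTheory.QuadraticForms
open Summit.HodgeConjecture.HodgeConjecture.Cruxes.HLiu418.F0LD2LineThetaTypesComplementaryDefs
open Summit.HodgeConjecture.HodgeConjecture.Cruxes.HLiu418.F0LD2LineComplementaryOfDisjoint

namespace Summit.HodgeConjecture.HodgeConjecture.Cruxes.HLiu418.F0LD2SoftRoadJunction

set_option synthInstance.maxHeartbeats 400000 in
set_option maxHeartbeats 4000000 in -- δ-docking of the spelled ★ heads + the doubled CM datum's telescope
/-- **THE ORGAN `LineThetaTypesComplementary₁` MODULO EXACTLY {`ZLambda`, `ZVan`}** (EDITION 1): the soft-road composition ★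
`lineThetaTypesComplementary₁_of_softRoad` at (E) ★ `centreDetCharExists`, (Z) ⟸ (Z-Λ) ∧ (Z-van) by contradiction (inlined), and (D) → (C) ★
`coinvDisjoint₁_of_kudlaLinesDisjoint`. [cite: GelbartRogawski1991, §3.2 (3.2.2)–(3.2.3) p. 457] [cite: HarrisKudlaSweet1996, §6 Thm. 6.1]
[cite: Kudla1994, §3 Thm. 3.1] [cite: MoeglinVignerasWaldspurger1987, Chap. 3 §IV.4] -/
theorem lineThetaTypesComplementary₁_of_z (hΛ : ZLambda) (hV : ZVan) : LineThetaTypesComplementary₁ :=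
  lineThetaTypesComplementary₁_of_softRoad F0LD2CentreDetCharExists.centreDetCharExists
    (by
      intro L _ _ _ v _ _ μ _ hE T₁ T₂ hT₁ hT₂ hT₁d hT₂d α hTT' hclass T hT hTs hTd J₁ hJ₁ J hJ χ hχ J' hJ'0 e' he'o he' h
      obtain ⟨Λ, hne, hinv⟩ := hΛ L v μ hE hTs hTd hJ χ hχ (J₁ := J₁) hJ'0 e' he'o he'
        (JD₁ := (gramD (maximalRealSubfield L) 1 1).map (algebraMap (maximalRealSubfield L) L)) rfl h
      exact hne (hV L v μ hE hT₁ hT₂ hT₁d hT₂d α hTT' hclass hT hTs hTd χ hχ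
        (JD₁ := (gramD (maximalRealSubfield L) 1 1).map (algebraMap (maximalRealSubfield L) L)) rfl Λ hinv))
    F0LD2KudlaLinesToCoinvDisjoint.coinvDisjoint₁_of_kudlaLinesDisjoint


/-! ## EDITION 2 — (Z-Λ) docked by name: the organ from (Z-van) alone -/

set_option synthInstance.maxHeartbeats 400000 in
set_option maxHeartbeats 4000000 in -- δ-docking of ★ `zLambda_body` (the body of `ZLambda` verbatim) + the doubled CM datum's telescope
/-- **THE ORGAN `LineThetaTypesComplementary₁` FROM (Z-van) ALONE** (EDITION 2): (Z-Λ) is ★ `F0LD2SoftRoadZLambda.zLambda_body` (B-p04 (g45); the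
twist on `inl U(W)` is the centre character, so a centre type yields a non-zero twisted-section-invariant functional), docked by δ against `ZLambda`.
[cite: GelbartRogawski1991, §3.2 (3.2.2)–(3.2.3) p. 457] [cite: HarrisKudlaSweet1996, §6 Thm. 6.1] [cite: MoeglinVignerasWaldspurger1987, Chap. 3 §IV.4] -/
theorem lineThetaTypesComplementary₁_of_zVan (hV : ZVan) : LineThetaTypesComplementary₁ :=
  lineThetaTypesComplementary₁_of_z F0LD2SoftRoadZLambda.zLambda_body hV


/-! ## EDITION 3 — (Z-van) docked by name: the organ, unconditionally -/

/-- **THE ORGAN `LineThetaTypesComplementary₁` HOLDS** (EDITION 3; books row #188): the two CM line theta packages have complementary local types —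
the soft road end to end: (E) ★ `centreDetCharExists` (A-p13), (Z-Λ) ★ `zLambda_body` (B-p04), (Z-van) ★ `zVan_holds` (A-p19: the Siegel-unipotent and
Weyl operator words of the twisted section + the anisotropic-plane vanishing of invariant functionals, with B-p08, LD2-p01, LD2-p02, B-p04, A-p16),
(D) → (C) ★ `coinvDisjoint₁_of_kudlaLinesDisjoint` (B-p04), glue ★ `F0LD2SoftRoadGlue` (LD2-plan).
[cite: GelbartRogawski1991, §3.2 (3.2.2)–(3.2.3) p. 457] [cite: HarrisKudlaSweet1996, §6 Thm. 6.1] [cite: Kudla1994, §3 Thm. 3.1]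
[cite: MoeglinVignerasWaldspurger1987, Chap. 3 §IV.4] -/
theorem lineThetaTypesComplementary₁_holds : LineThetaTypesComplementary₁ :=
  lineThetaTypesComplementary₁_of_zVan zVan_holds

end Summit.HodgeConjecture.HodgeConjecture.Cruxes.HLiu418.F0LD2SoftRoadJunction

end
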